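import Literature.Analysis.FunctionSpaces.BesovFatou
import HarnessLib

/-!
# Spatial translations on `𝓢'(E, F)`; translation invariance of the `L^p` and Besov norms

Analysis/FunctionSpaces support file. The translation `τ_b u = u(· - b)` of a tempered
distribution by `b ∈ E`, defined by duality (`⟨τ_b u, φ⟩ = ⟨u, φ(· + b)⟩`; Bahouri–Chemin–Danchin
2011, §1.2.1; Reed–Simon II, §IX.1 — Mathlib has the translation of Schwartz *functions*,
`SchwartzMap.compSubConstCLM`, but no operation on `𝓢'`), and the facts every blow-up argument
"around a point `x₀`" uses:

* `distribTranslate b : 𝓢'(E, F) →L[ℂ] 𝓢'(E, F)` (**definition**), `distribTranslate_apply_apply`,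
  the group law (`distribTranslate_zero`, `distribTranslate_add`), and compatibility with the
  translation of `L^p` functions (`distribTranslate_coe`);
* `eLpNormDistrib_distribTranslate` — `‖τ_b u‖_{L^p} = ‖u‖_{L^p}` in `[0, ∞]`;
* `fourierMultiplierCLM_schwartz_distribTranslate` — Fourier multipliers with Schwartz symbol
  (in particular the Littlewood–Paley blocks `Δ̇_j` and cut-offs `Ṡ_j`: `lpBlock_distribTranslate`,
  `lowFreqCutoff_distribTranslate`) commute with translations — proved *without* Fourier phases,
  from the pointwise representation `⟨Ψ(D)u, θ⟩ = ∫ θ(a) ⟨u, (𝓕Ψ)(· - a)⟩ da` of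
  `BesovFatou.lean` and the translation invariance of the Haar integral;
* `lpBlockWeight_distribTranslate`, `eHomBesovNorm_distribTranslate` —
  **`‖u(· - b)‖_{Ḃ^s_{p,q}} = ‖u‖_{Ḃ^s_{p,q}}`** (BCD Prop. 2.18: the homogeneous Besov norms are
  translation invariant), and `MemHomBesov.distribTranslate` (the realisation condition is
  preserved).

## References

* H. Bahouri, J.-Y. Chemin, R. Danchin, *Fourier Analysis and Nonlinear PDE* (2011), §1.2.1
  (operations on `𝓢'` by duality), Prop. 2.18 (invariances of `Ḃ^s_{p,r}`).
  [BahouriCheminDanchin2011]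
* M. Reed, B. Simon, *Methods of Modern Mathematical Physics II* (1975), §IX.1. [ReedSimonII1975]
-/

noncomputable section

open MeasureTheory TemperedDistribution Filter Set Function
open _root_.Topology _root_.FourierTransform
open scoped SchwartzMap ENNReal NNReal

namespace Literature.Analysis.FunctionSpaces

/-! ## The translation operator on `𝓢'(E, F)` -/

section Translate

variable {E : Type*} [NormedAddCommGroup E] [NormedSpace ℝ E] {F : Type*} [NormedAddCommGroup F]
  [NormedSpace ℂ F]

variable (F) in
/-- **Translation of a tempered distribution** by `b ∈ E`: `τ_b u = u(· - b)`, defined by duality,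
`⟨τ_b u, φ⟩ = ⟨u, φ(· + b)⟩` (so that for a function `f`, `τ_b f` is the distribution of
`x ↦ f(x - b)`, `distribTranslate_coe`). Built from Mathlib's `SchwartzMap.compSubConstCLM` and
`PointwiseConvergenceCLM.precomp` (BCD §1.2.1). [cite: BahouriCheminDanchin2011, §1.2.1] -/
def distribTranslate (b : E) : 𝓢'(E, F) →L[ℂ] 𝓢'(E, F) :=
  PointwiseConvergenceCLM.precomp F (SchwartzMap.compSubConstCLM ℂ (-b))

/-- Unfolding: `⟨τ_b u, φ⟩ = ⟨u, φ(· + b)⟩ = ⟨u, compSubConstCLM (-b) φ⟩`. [folklore] -/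
theorem distribTranslate_apply_apply (b : E) (u : 𝓢'(E, F)) (φ : 𝓢(E, ℂ)) :
    distribTranslate F b u φ = u (SchwartzMap.compSubConstCLM ℂ (-b) φ) := rfl

/-- `τ_0 = id`. [folklore] -/
@[simp]
theorem distribTranslate_zero (u : 𝓢'(E, F)) : distribTranslate F (0 : E) u = u := by
  ext φ
  rw [distribTranslate_apply_apply, neg_zero, SchwartzMap.compSubConstCLM_zero]
  rfl

/-- The group law `τ_a (τ_b u) = τ_{a+b} u`. [folklore] -/
theorem distribTranslate_distribTranslate (a b : E) (u : 𝓢'(E, F)) :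
    distribTranslate F a (distribTranslate F b u) = distribTranslate F (a + b) u := by
  ext φ
  simp only [distribTranslate_apply_apply]
  congr 1
  ext x
  simp only [SchwartzMap.compSubConstCLM_apply]
  congr 1
  abel

/-- `τ_{-b} (τ_b u) = u`. [folklore] -/
@[simp]
theorem distribTranslate_neg_distribTranslate (b : E) (u : 𝓢'(E, F)) :
    distribTranslate F (-b) (distribTranslate F b u) = u := by
  rw [distribTranslate_distribTranslate, neg_add_cancel, distribTranslate_zero]

/-- `τ_b (τ_{-b} u) = u`. [folklore] -/
@[simp]
theorem distribTranslate_distribTranslate_neg (b : E) (u : 𝓢'(E, F)) :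
    distribTranslate F b (distribTranslate F (-b) u) = u := by
  rw [distribTranslate_distribTranslate, add_neg_cancel, distribTranslate_zero]

end Translate

/-! ## Translations of `L^p` functions and of their distributions -/

section Lp

variable {E : Type*} [NormedAddCommGroup E] [InnerProductSpace ℝ E] [FiniteDimensional ℝ E]
  [MeasurableSpace E] [BorelSpace E] {F : Type*} [NormedAddCommGroup F] [NormedSpace ℂ F]

omit [NormedSpace ℂ F] in
/-- `f ∈ L^p ⇒ f(· - b) ∈ L^p`, with the same norm (translation invariance of the Haar
measure). [folklore] -/
theorem memLp_comp_sub_right {p : ℝ≥0∞} (f : Lp F p (volume : Measure E)) (b : E) :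
    MemLp (fun x => (f : E → F) (x - b)) p volume :=
  (Lp.memLp f).comp_measurePreserving (measurePreserving_sub_right volume b)

omit [NormedSpace ℂ F] in
/-- `‖f(· - b)‖_{L^p} = ‖f‖_{L^p}`. [folklore] -/
theorem eLpNorm_comp_sub_right (p : ℝ≥0∞) (f : E → F) (hf : AEStronglyMeasurable f volume)
    (b : E) : eLpNorm (fun x => f (x - b)) p volume = eLpNorm f p volume :=
  eLpNorm_comp_measurePreserving hf (measurePreserving_sub_right volume b)

variable [CompleteSpace F]

/-- **The translation of distributions extends the translation of functions**: for `f ∈ L^p` and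
`g = f(· - b) ∈ L^p` (a.e.), `τ_b f = g` as tempered distributions
(`∫ φ(x + b) f(x) dx = ∫ φ(x) f(x - b) dx`). [cite: BahouriCheminDanchin2011, §1.2.1] -/
theorem distribTranslate_coe {p : ℝ≥0∞} [Fact (1 ≤ p)] (b : E) (f g : Lp F p (volume : Measure E))
    (hfg : (g : E → F) =ᵐ[volume] fun x => (f : E → F) (x - b)) :
    distribTranslate F b (f : 𝓢'(E, F)) = (g : 𝓢'(E, F)) := by
  ext φ
  have hR : (g : 𝓢'(E, F)) φ = ∫ x, φ x • (f : E → F) (x - b) := by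
    rw [Lp.toTemperedDistribution_apply]
    exact integral_congr_ae (hfg.mono fun x hx => by simp [hx])
  rw [hR, distribTranslate_apply_apply, Lp.toTemperedDistribution_apply]
  rw [← integral_sub_right_eq_self (fun x => SchwartzMap.compSubConstCLM ℂ (-b) φ x • (f : E → F) x) b]
  refine integral_congr_ae (Eventually.of_forall fun x => ?_)
  simp only [SchwartzMap.compSubConstCLM_apply, sub_neg_eq_add, sub_add_cancel]

/-- **`‖τ_b u‖_{L^p} = ‖u‖_{L^p}` in `[0, ∞]`** for tempered distributions (both sides are `∞`
when `u ∉ L^p`, since `u ∈ L^p ↔ τ_b u ∈ L^p`). [cite: BahouriCheminDanchin2011, Prop. 2.18] -/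
theorem eLpNormDistrib_distribTranslate {p : ℝ≥0∞} [Fact (1 ≤ p)] (b : E) (u : 𝓢'(E, F)) :
    eLpNormDistrib p (distribTranslate F b u) = eLpNormDistrib p u := by
  -- one inequality for every `b`, then symmetry
  have key : ∀ (c : E) (v : 𝓢'(E, F)),
      eLpNormDistrib p (distribTranslate F c v) ≤ eLpNormDistrib p v := by
    intro c v
    by_cases hv : ∃ f : Lp F p (volume : Measure E), (f : 𝓢'(E, F)) = v
    · obtain ⟨f, rfl⟩ := hv
      have hg := memLp_comp_sub_right f c
      rw [distribTranslate_coe c f (hg.toLp _) (MemLp.coeFn_toLp hg), eLpNormDistrib_coe,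
        eLpNormDistrib_coe, Lp.enorm_def, Lp.enorm_def, eLpNorm_congr_ae (MemLp.coeFn_toLp hg),
        eLpNorm_comp_sub_right p _ (Lp.aestronglyMeasurable f) c]
    · push Not at hv
      rw [eLpNormDistrib_of_forall_ne hv]
      exact le_top
  refine le_antisymm (key b u) ?_
  calc eLpNormDistrib p u = eLpNormDistrib p (distribTranslate F (-b) (distribTranslate F b u)) := by
        rw [distribTranslate_neg_distribTranslate]
    _ ≤ eLpNormDistrib p (distribTranslate F b u) := key (-b) _

end Lp

/-! ## Fourier multipliers with Schwartz symbol commute with translations -/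

section Multipliers

variable {E : Type*} [NormedAddCommGroup E] [InnerProductSpace ℝ E] [FiniteDimensional ℝ E]
  [MeasurableSpace E] [BorelSpace E] {F : Type*} [NormedAddCommGroup F] [NormedSpace ℂ F]
  [CompleteSpace F]

/-- **`Ψ(D) τ_b = τ_b Ψ(D)` on `𝓢'(E, F)` for a Schwartz symbol `Ψ`** (BCD Prop. 2.18, translation
invariance of Fourier multipliers). Proof without Fourier phases: by the pointwise representation
`⟨Ψ(D)v, θ⟩ = ∫ θ(a) • ⟨v, κ(· - a)⟩ da`, `κ = 𝓕Ψ` (`fourierMultiplierCLM_schwartz_apply_eq_integral`),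
both sides equal `∫ θ(a) • ⟨u, κ(· - a + b)⟩ da`, up to the substitution `a ↦ a + b` in the Haar
integral. [cite: BahouriCheminDanchin2011, Prop. 2.18] -/
theorem fourierMultiplierCLM_schwartz_distribTranslate (Ψ : 𝓢(E, ℂ)) (b : E) (u : 𝓢'(E, F)) :
    fourierMultiplierCLM F (⇑Ψ) (distribTranslate F b u) =
      distribTranslate F b (fourierMultiplierCLM F (⇑Ψ) u) := by
  ext θ
  rw [fourierMultiplierCLM_schwartz_apply_eq_integral, distribTranslate_apply_apply,
    fourierMultiplierCLM_schwartz_apply_eq_integral]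
  -- left: `∫ θ(a) • ⟨τ_b u, κ(· - a)⟩ da = ∫ θ(a) • ⟨u, κ(· - (a - b))⟩ da`
  have hL : (fun a => θ a • distribTranslate F b u (SchwartzMap.compSubConstCLM ℂ a (𝓕 Ψ))) =
      fun a => θ a • u (SchwartzMap.compSubConstCLM ℂ (a - b) (𝓕 Ψ)) := by
    funext a
    rw [distribTranslate_apply_apply]
    congr 2
    ext x
    simp only [SchwartzMap.compSubConstCLM_apply]
    congr 1
    abel
  -- substitute `a ↦ a + b`; right: `∫ θ(a + b) • ⟨u, κ(· - a)⟩ da`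
  rw [hL, ← integral_add_right_eq_self
    (fun a => θ a • u (SchwartzMap.compSubConstCLM ℂ (a - b) (𝓕 Ψ))) b]
  refine integral_congr_ae (Eventually.of_forall fun a => ?_)
  simp only [SchwartzMap.compSubConstCLM_apply, add_sub_cancel_right, sub_neg_eq_add]

/-- Fourier multipliers with **smooth compactly supported symbol** commute with translations.
[cite: BahouriCheminDanchin2011, Prop. 2.18] -/
theorem fourierMultiplierCLM_distribTranslate_of_hasCompactSupport {g : E → ℂ}
    (hg : HasCompactSupport g) (hg' : ContDiff ℝ ((⊤ : ℕ∞) : WithTop ℕ∞) g) (b : E)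
    (u : 𝓢'(E, F)) :
    fourierMultiplierCLM F g (distribTranslate F b u) =
      distribTranslate F b (fourierMultiplierCLM F g u) :=
  fourierMultiplierCLM_schwartz_distribTranslate (hg.toSchwartzMap hg') b u

/-- **The dyadic blocks commute with translations**: `Δ̇_j (τ_b u) = τ_b (Δ̇_j u)`.
[cite: BahouriCheminDanchin2011, Prop. 2.18] -/
theorem lpBlock_distribTranslate (j : ℤ) (b : E) (u : 𝓢'(E, F)) :
    lpBlock j (distribTranslate F b u) = distribTranslate F b (lpBlock j u) := by
  rw [lpBlock_apply, lpBlock_apply, ← coe_dyadicSymbolSchwartz,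
    fourierMultiplierCLM_schwartz_distribTranslate]

/-- **The low-frequency cut-offs commute with translations**: `Ṡ_j (τ_b u) = τ_b (Ṡ_j u)`.
[cite: BahouriCheminDanchin2011, Prop. 2.18] -/
theorem lowFreqCutoff_distribTranslate (j : ℤ) (b : E) (u : 𝓢'(E, F)) :
    lowFreqCutoff j (distribTranslate F b u) = distribTranslate F b (lowFreqCutoff j u) := by
  rw [lowFreqCutoff_apply, lowFreqCutoff_apply]
  exact fourierMultiplierCLM_distribTranslate_of_hasCompactSupport
    (hasCompactSupport_lowFreqSymbol j) (contDiff_lowFreqSymbol j) b u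

/-! ## Translation invariance of the homogeneous Besov norms -/

/-- The Besov weights are translation invariant: `2^{js} ‖Δ̇_j (τ_b u)‖_{L^p} = 2^{js} ‖Δ̇_j u‖_{L^p}`.
[cite: BahouriCheminDanchin2011, Prop. 2.18] -/
theorem lpBlockWeight_distribTranslate (s : ℝ) (p : ℝ≥0∞) [Fact (1 ≤ p)] (b : E) (u : 𝓢'(E, F))
    (j : ℤ) : lpBlockWeight s p (distribTranslate F b u) j = lpBlockWeight s p u j := by
  simp only [lpBlockWeight]
  rw [lpBlock_distribTranslate, eLpNormDistrib_distribTranslate]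

/-- **Translation invariance of the homogeneous Besov norms**:
`‖τ_b u‖_{Ḃ^s_{p,q}} = ‖u‖_{Ḃ^s_{p,q}}` for every `s`, `1 ≤ p ≤ ∞`, `q`, `b ∈ E`, `u ∈ 𝓢'(E, F)`
(BCD Prop. 2.18). [cite: BahouriCheminDanchin2011, Prop. 2.18] -/
theorem eHomBesovNorm_distribTranslate (s : ℝ) (p q : ℝ≥0∞) [Fact (1 ≤ p)] (b : E)
    (u : 𝓢'(E, F)) : eHomBesovNorm s p q (distribTranslate F b u) = eHomBesovNorm s p q u := by
  unfold eHomBesovNorm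
  congr 1
  funext j
  exact lpBlockWeight_distribTranslate s p b u j

/-- The realisation condition `Ṡ_j u → 0` (`j → -∞`) is translation invariant. [folklore] -/
theorem tendsto_lowFreqCutoff_distribTranslate_atBot {u : 𝓢'(E, F)}
    (hu : Tendsto (fun j : ℤ => lowFreqCutoff j u) atBot (𝓝 0)) (b : E) :
    Tendsto (fun j : ℤ => lowFreqCutoff j (distribTranslate F b u)) atBot (𝓝 0) := by
  simp_rw [lowFreqCutoff_distribTranslate]
  have h := ((distribTranslate F b).continuous.tendsto (0 : 𝓢'(E, F))).comp hu
  rwa [map_zero] at h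

/-- **`Ḃ^s_{p,q}` is translation invariant** (BCD Prop. 2.18): `u ∈ Ḃ^s_{p,q} ⇒ τ_b u ∈ Ḃ^s_{p,q}`
(norm and realisation). [cite: BahouriCheminDanchin2011, Prop. 2.18] -/
theorem MemHomBesov.distribTranslate {s : ℝ} {p q : ℝ≥0∞} [Fact (1 ≤ p)] {u : 𝓢'(E, F)}
    (h : MemHomBesov s p q u) (b : E) : MemHomBesov s p q (distribTranslate F b u) :=
  ⟨by rw [eHomBesovNorm_distribTranslate]; exact h.1,
    tendsto_lowFreqCutoff_distribTranslate_atBot h.2 b⟩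

/-- `τ_b u ∈ Ḃ^s_{p,q} ↔ u ∈ Ḃ^s_{p,q}`. [cite: BahouriCheminDanchin2011, Prop. 2.18] -/
theorem memHomBesov_distribTranslate_iff {s : ℝ} {p q : ℝ≥0∞} [Fact (1 ≤ p)] {u : 𝓢'(E, F)}
    (b : E) : MemHomBesov s p q (distribTranslate F b u) ↔ MemHomBesov s p q u :=
  ⟨fun h => by simpa using h.distribTranslate (-b), fun h => h.distribTranslate b⟩

end Multipliers

end Literature.Analysis.FunctionSpaces

end
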